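import Literature.MathematicalPhysics.QuantumLattice.KohnLuttingerLindhardMeasurable
import Mathlib.Analysis.Analytic.IsolatedZeros
import Mathlib.Analysis.SpecialFunctions.Trigonometric.Deriv
import Mathlib.MeasureTheory.Topology
import Mathlib.MeasureTheory.Integral.IntervalIntegral.Periodic
import Mathlib.Algebra.Polynomial.Roots
import HarnessLib

/-!
# Tools for the s-representation of the square-lattice Lindhard function

Cell `gate-hubbard-kl`, item stmt-HubbardSuperconductivity-19294 `LindhardPointwiseIdentification`
(the pointwise identification `χ₀(q; μ) = ∫₀¹ ρ(μ; A₀(s), A₁(s)) ds` of the zero-temperature Lindhard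
function of Raghu–Kivelson–Scalapino eq. (5)). Four self-contained tools used by the assembly
`LindhardSRepresentation.lean`:

* `volume_setOf_eq_zero_of_analyticOnNhd` — the zero set of a real-analytic function on `ℝ` that
  does not vanish identically is Lebesgue-null (Mathlib's isolated-zeros principle in its
  codiscrete form + `ae_restrict_le_codiscreteWithin`); with it, the three families of exceptional
  first coordinates of the key lemma (`LindhardSliceKeyLemma.lean`) are null
  (`volume_setOf_crossing_eq_zero`, `volume_setOf_dZero_eq_zero`, `volume_setOf_degenerate_eq_zero`);
* `setLIntegral_Ico_comp_add_of_periodic` — `∫⁻_{[-π,π)} G(x + φ) dx = ∫⁻_{[-π,π)} G(x) dx` for a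
  `2π`-periodic `G` (fundamental domains of `2πℤ`);
* `lindhardIntegrand_squareDispersion_eq` — the Lindhard integrand of the square-lattice band in the
  coordinates `(k₀, k₁)`;
* `finite_setOf_vanHove` — for `0 < |μ| < 4` the parameters `s ∈ [0,1]` at which `μ` is a van Hove
  level `±2(A₀(s) - A₁(s))` of the interpolated band form a finite set (roots of a quartic with
  constant coefficient `μ²(1 - μ²/16) ≠ 0`).

Theorems only.

## References
* S. Raghu, S. A. Kivelson, D. J. Scalapino, Phys. Rev. B 81 (2010) 224505, §II eq. (5)
  [RaghuKivelsonScalapino2010].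
-/

noncomputable section

open Real Set MeasureTheory MeasureTheory.Measure Filter
open scoped Topology ENNReal

namespace Literature.MathematicalPhysics.QuantumLattice

/-! ### Zero sets of real-analytic functions are null -/

/-- **The zero set of a non-trivial real-analytic function on `ℝ` is Lebesgue-null** (isolated
zeros). [cite: RaghuKivelsonScalapino2010, §II (5)] -/
theorem volume_setOf_eq_zero_of_analyticOnNhd {f : ℝ → ℝ} (hf : AnalyticOnNhd ℝ f univ) {x₀ : ℝ}
    (hx₀ : f x₀ ≠ 0) : volume {x : ℝ | f x = 0} = 0 := by
  rcases hf.eqOn_zero_or_eventually_ne_zero_of_preconnected isPreconnected_univ with h | h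
  · exact absurd (h (mem_univ x₀)) hx₀
  · have hae : ∀ᵐ x ∂(volume.restrict (univ : Set ℝ)), f x ≠ 0 :=
      ae_restrict_le_codiscreteWithin MeasurableSet.univ h
    rw [Measure.restrict_univ] at hae
    exact measure_eq_zero_iff_ae_notMem.2 (hae.mono fun x hx h0 => hx h0)

/-- `x ↦ cos (x + c)` is real-analytic. [cite: RaghuKivelsonScalapino2010, §II (5)] -/
theorem analyticOnNhd_cos_add_const (c : ℝ) : AnalyticOnNhd ℝ (fun x : ℝ => Real.cos (x + c)) univ :=
  (Real.analyticOnNhd_cos (s := univ)).comp (analyticOnNhd_id.add analyticOnNhd_const) (mapsTo_univ _ _)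

section Exceptional

variable (μ q₀ q₁ : ℝ)

/-- **The crossing abscissae are null.** For `μ < 0` and `(q₀, q₁)` with `sin(q₀/2) ≠ 0` or
`sin(q₁/2) ≠ 0` (i.e. `q ∉ 2πℤ²`), the set of `x` for which some `y` satisfies
`d(x) + 2 cos y - 2 cos(y + q₁) = 0` and `-2 cos y = μ + 2 cos x` (`(x, y)` a crossing point of the
Fermi curve `{-2(cos k₀ + cos k₁) = μ}` and its `q`-translate) is Lebesgue-null: it lies in the zero
set of the trigonometric polynomial `(c₁ cos q₁ - c₂)² - (1 - c₁²) sin² q₁`,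
`c₁ = -(μ + 2cos x)/2`, `c₂ = -μ/2 - cos(x + q₀)`, which does not vanish at `x = π`
(resp. `x = π/2 - q₀/2`). [cite: RaghuKivelsonScalapino2010, §II (5)] -/
theorem volume_setOf_crossing_eq_zero (hμ : μ < 0) (hq : Real.sin (q₀ / 2) ≠ 0 ∨ Real.sin (q₁ / 2) ≠ 0) :
    volume {x : ℝ | ∃ y : ℝ, (2 * Real.cos x - 2 * Real.cos (x + q₀)) + (2 * Real.cos y - 2 * Real.cos (y + q₁)) = 0 ∧
      -2 * Real.cos y = μ + 2 * Real.cos x} = 0 := by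
  set T : ℝ → ℝ := fun x => (-(μ + 2 * Real.cos x) / 2 * Real.cos q₁ - (-μ / 2 - Real.cos (x + q₀))) ^ 2 -
    (1 - (-(μ + 2 * Real.cos x) / 2) ^ 2) * Real.sin q₁ ^ 2 with hT
  have hTa : AnalyticOnNhd ℝ T univ := by
    have hcd : ContDiff ℝ (⊤ : WithTop ℕ∞) T := by rw [hT]; fun_prop
    exact hcd.analyticOnNhd
  -- the crossing set lies in the zero set of `T`
  have hsub : {x : ℝ | ∃ y : ℝ, (2 * Real.cos x - 2 * Real.cos (x + q₀)) + (2 * Real.cos y - 2 * Real.cos (y + q₁)) = 0 ∧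
      -2 * Real.cos y = μ + 2 * Real.cos x} ⊆ {x : ℝ | T x = 0} := by
    rintro x ⟨y, hD, ht⟩
    simp only [mem_setOf_eq, hT]
    have hc1 : Real.cos y = -(μ + 2 * Real.cos x) / 2 := by linarith
    have hc2 : Real.cos (y + q₁) = -μ / 2 - Real.cos (x + q₀) := by linarith
    have hsin : Real.sin y * Real.sin q₁ = -(μ + 2 * Real.cos x) / 2 * Real.cos q₁ - (-μ / 2 - Real.cos (x + q₀)) := by
      rw [← hc1, ← hc2, Real.cos_add]; ring
    have hpy := Real.sin_sq_add_cos_sq y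
    rw [← hsin, ← hc1]
    nlinarith [hpy]
  refine measure_mono_null hsub ?_
  -- a point where `T ≠ 0`
  by_cases hs : Real.sin q₁ = 0
  · have hcq : Real.cos q₁ = 1 ∨ Real.cos q₁ = -1 := by
      have h := Real.sin_sq_add_cos_sq q₁
      rw [hs] at h
      have : (Real.cos q₁ - 1) * (Real.cos q₁ + 1) = 0 := by nlinarith
      rcases mul_eq_zero.1 this with h1 | h1
      · exact Or.inl (by linarith)
      · exact Or.inr (by linarith)
    -- with `sin q₁ = 0` the hypothesis forces `sin (q₀/2) ≠ 0` unless `cos q₁ = -1`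
    rcases hcq with hc1 | hc1
    · -- `cos q₁ = 1`: `T = (d/2)² `, `d(π/2 - q₀/2) = 4 sin(q₀/2) ≠ 0`
      have hq0 : Real.sin (q₀ / 2) ≠ 0 := by
        rcases hq with h | h
        · exact h
        · exfalso; apply h
          have h2 : Real.sin (q₁ / 2) ^ 2 = 1 / 2 - Real.cos q₁ / 2 := by
            rw [Real.sin_sq, Real.cos_sq (q₁ / 2), show 2 * (q₁ / 2) = q₁ by ring]; ring
          rw [hc1] at h2
          exact pow_eq_zero_iff two_ne_zero |>.1 (by linarith)
      refine volume_setOf_eq_zero_of_analyticOnNhd hTa (x₀ := π / 2 - q₀ / 2) ?_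
      have e1 : Real.cos (π / 2 - q₀ / 2) = Real.sin (q₀ / 2) := Real.cos_pi_div_two_sub _
      have e2 : Real.cos (π / 2 - q₀ / 2 + q₀) = -Real.sin (q₀ / 2) := by
        rw [show π / 2 - q₀ / 2 + q₀ = q₀ / 2 + π / 2 by ring]; exact Real.cos_add_pi_div_two _
      simp only [hT, hs, hc1, e1, e2]
      intro h0
      apply hq0
      nlinarith [h0]
    · -- `cos q₁ = -1`: `T = (μ + cos x + cos(x+q₀))²`, `= μ² ≠ 0` at `x = π/2 - q₀/2`
      refine volume_setOf_eq_zero_of_analyticOnNhd hTa (x₀ := π / 2 - q₀ / 2) ?_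
      have e1 : Real.cos (π / 2 - q₀ / 2) = Real.sin (q₀ / 2) := Real.cos_pi_div_two_sub _
      have e2 : Real.cos (π / 2 - q₀ / 2 + q₀) = -Real.sin (q₀ / 2) := by
        rw [show π / 2 - q₀ / 2 + q₀ = q₀ / 2 + π / 2 by ring]; exact Real.cos_add_pi_div_two _
      simp only [hT, hs, hc1, e1, e2]
      intro h0
      have : μ ^ 2 = 0 := by nlinarith [h0]
      exact hμ.ne (pow_eq_zero_iff two_ne_zero |>.1 this)
  · -- `sin q₁ ≠ 0`: at `x = π`, `c₁ = 1 - μ/2 > 1`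
    refine volume_setOf_eq_zero_of_analyticOnNhd hTa (x₀ := π) ?_
    simp only [hT, Real.cos_pi]
    have h1 : 1 < -(μ + 2 * (-1 : ℝ)) / 2 := by linarith
    have h2 : 0 < Real.sin q₁ ^ 2 := by positivity
    nlinarith [sq_nonneg (-(μ + 2 * (-1 : ℝ)) / 2 * Real.cos q₁ - (-μ / 2 - Real.cos (π + q₀))),
      mul_pos (show 0 < (-(μ + 2 * (-1 : ℝ)) / 2) ^ 2 - 1 by nlinarith) h2]

/-- **The `d = 0` abscissae are null** when `sin(q₀/2) ≠ 0`: `2 cos x - 2 cos(x + q₀) = 0` only on a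
null set (`d = 4 sin(q₀/2) sin(x + q₀/2)` is a non-trivial trigonometric polynomial).
[cite: RaghuKivelsonScalapino2010, §II (5)] -/
theorem volume_setOf_dZero_eq_zero (hq : Real.sin (q₀ / 2) ≠ 0) :
    volume {x : ℝ | 2 * Real.cos x - 2 * Real.cos (x + q₀) = 0} = 0 := by
  have ha : AnalyticOnNhd ℝ (fun x : ℝ => 2 * Real.cos x - 2 * Real.cos (x + q₀)) univ :=
    (by fun_prop : ContDiff ℝ (⊤ : WithTop ℕ∞) (fun x : ℝ => 2 * Real.cos x - 2 * Real.cos (x + q₀))).analyticOnNhd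
  refine volume_setOf_eq_zero_of_analyticOnNhd ha (x₀ := π / 2 - q₀ / 2) ?_
  have e1 : Real.cos (π / 2 - q₀ / 2) = Real.sin (q₀ / 2) := Real.cos_pi_div_two_sub _
  have e2 : Real.cos (π / 2 - q₀ / 2 + q₀) = -Real.sin (q₀ / 2) := by
    rw [show π / 2 - q₀ / 2 + q₀ = q₀ / 2 + π / 2 by ring]; exact Real.cos_add_pi_div_two _
  rw [e1, e2]
  intro h
  apply hq
  linarith

/-- **The degenerate abscissae are null**: for `μ ≠ 0`, `2(μ + 2 cos x) = 2 cos x - 2 cos(x + q₀)`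
only on a null set. [cite: RaghuKivelsonScalapino2010, §II (5)] -/
theorem volume_setOf_degenerate_eq_zero (hμ : μ ≠ 0) :
    volume {x : ℝ | 2 * (μ + 2 * Real.cos x) = 2 * Real.cos x - 2 * Real.cos (x + q₀)} = 0 := by
  have ha : AnalyticOnNhd ℝ (fun x : ℝ => 2 * (μ + 2 * Real.cos x) - (2 * Real.cos x - 2 * Real.cos (x + q₀))) univ :=
    (by fun_prop : ContDiff ℝ (⊤ : WithTop ℕ∞)
      (fun x : ℝ => 2 * (μ + 2 * Real.cos x) - (2 * Real.cos x - 2 * Real.cos (x + q₀)))).analyticOnNhd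
  have hsub : {x : ℝ | 2 * (μ + 2 * Real.cos x) = 2 * Real.cos x - 2 * Real.cos (x + q₀)} ⊆
      {x : ℝ | 2 * (μ + 2 * Real.cos x) - (2 * Real.cos x - 2 * Real.cos (x + q₀)) = 0} := fun x hx => by
    simp only [mem_setOf_eq] at hx ⊢; linarith
  refine measure_mono_null hsub (volume_setOf_eq_zero_of_analyticOnNhd ha (x₀ := π / 2 - q₀ / 2) ?_)
  have e1 : Real.cos (π / 2 - q₀ / 2) = Real.sin (q₀ / 2) := Real.cos_pi_div_two_sub _
  have e2 : Real.cos (π / 2 - q₀ / 2 + q₀) = -Real.sin (q₀ / 2) := by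
    rw [show π / 2 - q₀ / 2 + q₀ = q₀ / 2 + π / 2 by ring]; exact Real.cos_add_pi_div_two _
  rw [e1, e2]
  intro h
  apply hμ
  linarith

end Exceptional

/-! ### Translation invariance of `∫_{[-π,π)}` for `2π`-periodic integrands -/

/-- For a `2π`-periodic `G : ℝ → ℝ≥0∞`, the integral over a period does not depend on the period
window: `∫⁻_{Ioc t (t+2π)} G = ∫⁻_{Ioc s (s+2π)} G` (fundamental domains of `2πℤ`).
[cite: RaghuKivelsonScalapino2010, §II (5)] -/
theorem setLIntegral_Ioc_eq_of_periodic {G : ℝ → ℝ≥0∞} (hG : Function.Periodic G (2 * π)) (t s : ℝ) :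
    ∫⁻ x in Ioc t (t + 2 * π), G x = ∫⁻ x in Ioc s (s + 2 * π), G x := by
  haveI : VAddInvariantMeasure (AddSubgroup.zmultiples (2 * π)) ℝ volume :=
    ⟨fun c s _ => measure_preimage_add _ _ _⟩
  exact IsAddFundamentalDomain.setLIntegral_eq (isAddFundamentalDomain_Ioc Real.two_pi_pos t)
    (isAddFundamentalDomain_Ioc Real.two_pi_pos s) G hG.map_vadd_zmultiples

/-- **Translation invariance on a period**: for a `2π`-periodic `G : ℝ → ℝ≥0∞` and every `φ`,
`∫⁻_{x ∈ [-π,π)} G(x + φ) dx = ∫⁻_{x ∈ [-π,π)} G(x) dx`. [cite: RaghuKivelsonScalapino2010, §II (5)] -/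
theorem setLIntegral_Ico_comp_add_of_periodic {G : ℝ → ℝ≥0∞} (hG : Function.Periodic G (2 * π)) (φ : ℝ) :
    ∫⁻ x in Ico (-π) π, G (x + φ) = ∫⁻ x in Ico (-π) π, G x := by
  have hπ := Real.pi_pos
  -- replace `Ico` by `Ioc` (endpoints are null)
  have hIco : ∀ F : ℝ → ℝ≥0∞, ∫⁻ x in Ico (-π) π, F x = ∫⁻ x in Ioc (-π) π, F x := fun F =>
    setLIntegral_congr (Ico_ae_eq_Ioc' (by simp) (by simp))
  rw [hIco, hIco]
  -- translate the window, then use periodicity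
  have h1 : ∫⁻ x in Ioc (-π) π, G (x + φ) = ∫⁻ x in Ioc (-π + φ) (π + φ), G x := by
    rw [← lintegral_indicator measurableSet_Ioc, ← lintegral_indicator measurableSet_Ioc,
      ← lintegral_add_right_eq_self (μ := (volume : Measure ℝ))
        (fun x => (Ioc (-π + φ) (π + φ)).indicator G x) φ]
    congr 1
    funext x
    simp only [Set.indicator_apply, mem_Ioc]
    have : (-π < x ∧ x ≤ π) ↔ (-π + φ < x + φ ∧ x + φ ≤ π + φ) := by
      constructor <;> rintro ⟨h1, h2⟩ <;> constructor <;> linarith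
    simp only [this]
  rw [h1, show π + φ = (-π + φ) + 2 * π by ring, setLIntegral_Ioc_eq_of_periodic hG (-π + φ) (-π),
    show -π + 2 * π = π by ring]

/-! ### The Lindhard integrand of the square-lattice band in coordinates -/

/-- The zero-temperature Lindhard integrand of `ε = -2(cos k₀ + cos k₁)` in the coordinates
`x = p₀`, `y = p₁`: zero where the occupations of `p` and `p + q` agree, else
`1/(|ε(p) - μ| + |ε(p+q) - μ|)`. [cite: RaghuKivelsonScalapino2010, §II (5)] -/
theorem lindhardIntegrand_squareDispersion_eq (μ : ℝ) (q p : Momentum) :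
    lindhardIntegrand (squareDispersion 1 0) μ q p =
      if (-2 * (Real.cos (p 0) + Real.cos (p 1)) < μ ↔ -2 * (Real.cos (p 0 + q 0) + Real.cos (p 1 + q 1)) < μ) then 0
      else 1 / (|-2 * (Real.cos (p 0) + Real.cos (p 1)) - μ| + |-2 * (Real.cos (p 0 + q 0) + Real.cos (p 1 + q 1)) - μ|) := by
  have hε : ∀ k : Momentum, squareDispersion 1 0 k = -2 * (Real.cos (k 0) + Real.cos (k 1)) := fun k => by
    simp only [squareDispersion]; ring
  have hadd : ∀ i, (p + q) i = p i + q i := fun i => rfl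
  rw [lindhardIntegrand_eq_ite_inv]
  simp only [fermiOccupation, hε, hadd]
  by_cases h1 : -(2 * (Real.cos (p 0) + Real.cos (p 1))) < μ <;>
    by_cases h2 : -(2 * (Real.cos (p 0 + q 0) + Real.cos (p 1 + q 1))) < μ <;>
    simp [h1, h2]

/-! ### The van Hove parameters form a finite set -/

/-- **Finiteness of the van Hove parameters.** For `0 < |μ| < 4` and `S₀, S₁ ∈ [0,1]`
(`= sin²(q₀/2), sin²(q₁/2)`) the set of `s ∈ [0,1]` with `μ = ±2(A₀(s) - A₁(s))`,
`A_i(s) = √(1 - 4s(1-s)S_i)`, is finite: squaring twice, `s` is a root of the quartic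
`μ²A₁(s)² - (4s(1-s)(S₁-S₀) - μ²/4)²` (resp. with `0 ↔ 1`), whose value at `s = 0` is
`μ²(1 - μ²/16) ≠ 0`. [cite: RaghuKivelsonScalapino2010, §II (5)] -/
theorem finite_setOf_vanHove (μ S₀ S₁ : ℝ) (hμ0 : μ ≠ 0) (hμ4 : μ ^ 2 < 16)
    (hS₀ : 0 ≤ S₀) (hS₀' : S₀ ≤ 1) (hS₁ : 0 ≤ S₁) (hS₁' : S₁ ≤ 1) :
    Set.Finite {s : ℝ | s ∈ Icc (0 : ℝ) 1 ∧
      (μ = 2 * (Real.sqrt (1 - 4 * s * (1 - s) * S₀) - Real.sqrt (1 - 4 * s * (1 - s) * S₁)) ∨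
       μ = 2 * (Real.sqrt (1 - 4 * s * (1 - s) * S₁) - Real.sqrt (1 - 4 * s * (1 - s) * S₀)))} := by
  -- the two quartics
  set P : Polynomial ℝ := Polynomial.C (μ ^ 2) * (1 - Polynomial.C (4 * S₁) * Polynomial.X * (1 - Polynomial.X)) -
    (Polynomial.C (4 * (S₁ - S₀)) * Polynomial.X * (1 - Polynomial.X) - Polynomial.C (μ ^ 2 / 4)) ^ 2 with hP
  set P' : Polynomial ℝ := Polynomial.C (μ ^ 2) * (1 - Polynomial.C (4 * S₀) * Polynomial.X * (1 - Polynomial.X)) -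
    (Polynomial.C (4 * (S₀ - S₁)) * Polynomial.X * (1 - Polynomial.X) - Polynomial.C (μ ^ 2 / 4)) ^ 2 with hP'
  have hPe : ∀ s : ℝ, P.eval s = μ ^ 2 * (1 - 4 * S₁ * s * (1 - s)) - (4 * (S₁ - S₀) * s * (1 - s) - μ ^ 2 / 4) ^ 2 := by
    intro s; simp only [hP, Polynomial.eval_sub, Polynomial.eval_mul, Polynomial.eval_C, Polynomial.eval_X,
      Polynomial.eval_pow, Polynomial.eval_one]
  have hP'e : ∀ s : ℝ, P'.eval s = μ ^ 2 * (1 - 4 * S₀ * s * (1 - s)) - (4 * (S₀ - S₁) * s * (1 - s) - μ ^ 2 / 4) ^ 2 := by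
    intro s; simp only [hP', Polynomial.eval_sub, Polynomial.eval_mul, Polynomial.eval_C, Polynomial.eval_X,
      Polynomial.eval_pow, Polynomial.eval_one]
  have hval0 : μ ^ 2 * (1 - 4 * S₁ * 0 * (1 - 0)) - (4 * (S₁ - S₀) * 0 * (1 - 0) - μ ^ 2 / 4) ^ 2 ≠ 0 := by
    have : μ ^ 2 * (1 - 4 * S₁ * 0 * (1 - 0)) - (4 * (S₁ - S₀) * 0 * (1 - 0) - μ ^ 2 / 4) ^ 2 =
        μ ^ 2 * (16 - μ ^ 2) / 16 := by ring
    rw [this]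
    have hμ2 : 0 < μ ^ 2 := by positivity
    have : 0 < μ ^ 2 * (16 - μ ^ 2) / 16 := by nlinarith
    exact this.ne'
  have hval0' : μ ^ 2 * (1 - 4 * S₀ * 0 * (1 - 0)) - (4 * (S₀ - S₁) * 0 * (1 - 0) - μ ^ 2 / 4) ^ 2 ≠ 0 := by
    have : μ ^ 2 * (1 - 4 * S₀ * 0 * (1 - 0)) - (4 * (S₀ - S₁) * 0 * (1 - 0) - μ ^ 2 / 4) ^ 2 =
        μ ^ 2 * (16 - μ ^ 2) / 16 := by ring
    rw [this]
    have hμ2 : 0 < μ ^ 2 := by positivity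
    have : 0 < μ ^ 2 * (16 - μ ^ 2) / 16 := by nlinarith
    exact this.ne'
  have hP0 : P ≠ 0 := fun h => hval0 (by rw [← hPe 0, h, Polynomial.eval_zero])
  have hP'0 : P' ≠ 0 := fun h => hval0' (by rw [← hP'e 0, h, Polynomial.eval_zero])
  refine ((Polynomial.finite_setOf_isRoot hP0).union (Polynomial.finite_setOf_isRoot hP'0)).subset ?_
  rintro s ⟨hs, hμ⟩
  -- the radicands are nonnegative on `[0,1]`
  have hss : 0 ≤ 4 * s * (1 - s) ∧ 4 * s * (1 - s) ≤ 1 := by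
    constructor <;> nlinarith [hs.1, hs.2, sq_nonneg (2 * s - 1)]
  have hR₀ : 0 ≤ 1 - 4 * s * (1 - s) * S₀ := by nlinarith
  have hR₁ : 0 ≤ 1 - 4 * s * (1 - s) * S₁ := by nlinarith
  set A₀ := Real.sqrt (1 - 4 * s * (1 - s) * S₀) with hA₀
  set A₁ := Real.sqrt (1 - 4 * s * (1 - s) * S₁) with hA₁
  have hA₀sq : A₀ ^ 2 = 1 - 4 * s * (1 - s) * S₀ := Real.sq_sqrt hR₀
  have hA₁sq : A₁ ^ 2 = 1 - 4 * s * (1 - s) * S₁ := Real.sq_sqrt hR₁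
  rcases hμ with h | h
  · -- `μ/2 + A₁ = A₀`: `s` is a root of `P`
    left
    simp only [mem_setOf_eq, Polynomial.IsRoot.def, hPe]
    have hA0 : A₀ = μ / 2 + A₁ := by linarith
    have hsq : (μ / 2 + A₁) ^ 2 = 1 - 4 * s * (1 - s) * S₀ := by rw [← hA0]; exact hA₀sq
    have h1 : μ * A₁ = 4 * (S₁ - S₀) * s * (1 - s) - μ ^ 2 / 4 := by linear_combination hsq - hA₁sq
    have h2 : (μ * A₁) ^ 2 = μ ^ 2 * (1 - 4 * S₁ * s * (1 - s)) := by rw [mul_pow, hA₁sq]; ring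
    rw [← h1, ← h2]; ring
  · right
    simp only [mem_setOf_eq, Polynomial.IsRoot.def, hP'e]
    have hA1 : A₁ = μ / 2 + A₀ := by linarith
    have hsq : (μ / 2 + A₀) ^ 2 = 1 - 4 * s * (1 - s) * S₁ := by rw [← hA1]; exact hA₁sq
    have h1 : μ * A₀ = 4 * (S₀ - S₁) * s * (1 - s) - μ ^ 2 / 4 := by linear_combination hsq - hA₀sq
    have h2 : (μ * A₀) ^ 2 = μ ^ 2 * (1 - 4 * S₀ * s * (1 - s)) := by rw [mul_pow, hA₀sq]; ring
    rw [← h1, ← h2]; ring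

end Literature.MathematicalPhysics.QuantumLattice

end
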